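import Mathlib
import Summits.Ventures.PercRepro2.Defs
import Summits.Ventures.PercRepro2.CoinTraceBlock
import Summits.Ventures.PercRepro2.CoinTraceShift
import Summits.Ventures.PercRepro2.CoinTraceBlocks
import Summits.Ventures.PercRepro2.CoinTraceBlocks2
import Summits.Ventures.PercRepro2.CoinTwoChainsHard

/-!
# The ten pivotal up-sets of TWO CHAINS OF LENGTH 2 (blind cell PercRepro2, night-2 g4;
proofs/NIGHT2-DARC.md §24.3)

`twoChains_wtrace_classify`: the traces containing `w` with nonzero mass are `A = wv₁v₂`,
`B = wv₃v₄`, `C = wv₁v₂v₄`, `D = wv₂v₃v₄`, `E = P`.  `twoChains_upset_block_nonneg`: given the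
ten blocks (∅, {E}, the four vertex families, the whole family, and the three union-type up-sets
`{C,E}`, `{D,E}`, `{C,D,E}`), EVERY up-set of the pivotal family has a nonnegative block — the
input of the finite layer cake in CoinTwoChainsAbstract2.lean.
-/

namespace Summit.Ventures.PercRepro2.Coin

section TwoChainsUpsets

open Classical

variable {V : Type*} [DecidableEq V] {R : Type*} [Field R] [LinearOrder R] [IsStrictOrderedRing R]

omit [LinearOrder R] [IsStrictOrderedRing R] in
/-- The traces containing `w` with nonzero mass are `A, B, C, D, E`. -/
lemma twoChains_wtrace_classify {w v₁ v₂ v₃ v₄ : V} (hwv₁ : w ≠ v₁) (hwv₂ : w ≠ v₂)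
    (hwv₃ : w ≠ v₃) (hwv₄ : w ≠ v₄) (hv₁₂ : v₁ ≠ v₂) (hv₁₃ : v₁ ≠ v₃) (hv₁₄ : v₁ ≠ v₄)
    (hv₂₃ : v₂ ≠ v₃) (hv₂₄ : v₂ ≠ v₄) (hv₃₄ : v₃ ≠ v₄) (μ : Finset V → R)
    (hμ0a : ∀ Z ∈ ({w, v₁, v₂, v₃, v₄} : Finset V).powerset, v₁ ∈ Z → v₂ ∉ Z → μ Z = 0)
    (hμ0b : ∀ Z ∈ ({w, v₁, v₂, v₃, v₄} : Finset V).powerset, v₃ ∈ Z → v₄ ∉ Z → μ Z = 0)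
    (hμ0c : ∀ Z ∈ ({w, v₁, v₂, v₃, v₄} : Finset V).powerset, w ∈ Z → ¬ (v₁ ∈ Z ∧ v₂ ∈ Z) →
      ¬ (v₃ ∈ Z ∧ v₄ ∈ Z) → μ Z = 0)
    {Z : Finset V} (hZ : Z ∈ ({w, v₁, v₂, v₃, v₄} : Finset V).powerset) (hwZ : w ∈ Z)
    (hμZ : μ Z ≠ 0) :
    Z = {w, v₁, v₂} ∨ Z = {w, v₃, v₄} ∨ Z = {w, v₁, v₂, v₄} ∨ Z = {w, v₂, v₃, v₄} ∨
      Z = ({w, v₁, v₂, v₃, v₄} : Finset V) := by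
  have hZP : Z ⊆ ({w, v₁, v₂, v₃, v₄} : Finset V) := Finset.mem_powerset.mp hZ
  have hel : ∀ z ∈ Z, z = w ∨ z = v₁ ∨ z = v₂ ∨ z = v₃ ∨ z = v₄ := by
    intro z hz
    have := hZP hz
    simpa only [Finset.mem_insert, Finset.mem_singleton] using this
  by_cases h1 : v₁ ∈ Z <;> by_cases h2 : v₂ ∈ Z <;> by_cases h3 : v₃ ∈ Z <;> by_cases h4 : v₄ ∈ Z
  · -- `E`
    right; right; right; right
    apply Finset.Subset.antisymm hZP
    intro z hz
    simp only [Finset.mem_insert, Finset.mem_singleton] at hz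
    rcases hz with rfl | rfl | rfl | rfl | rfl <;> assumption
  · exact absurd (hμ0b Z hZ h3 h4) hμZ
  · -- `C`
    right; right; left
    apply Finset.Subset.antisymm
    · intro z hz
      rcases hel z hz with rfl | rfl | rfl | rfl | rfl
      · simp
      · simp
      · simp
      · exact absurd hz h3
      · simp
    · intro z hz
      simp only [Finset.mem_insert, Finset.mem_singleton] at hz
      rcases hz with rfl | rfl | rfl | rfl <;> assumption
  · -- `A`
    left
    apply Finset.Subset.antisymm
    · intro z hz
      rcases hel z hz with rfl | rfl | rfl | rfl | rfl
      · simp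
      · simp
      · simp
      · exact absurd hz h3
      · exact absurd hz h4
    · intro z hz
      simp only [Finset.mem_insert, Finset.mem_singleton] at hz
      rcases hz with rfl | rfl | rfl <;> assumption
  · exact absurd (hμ0a Z hZ h1 h2) hμZ
  · exact absurd (hμ0a Z hZ h1 h2) hμZ
  · exact absurd (hμ0a Z hZ h1 h2) hμZ
  · exact absurd (hμ0a Z hZ h1 h2) hμZ
  · -- `D`
    right; right; right; left
    apply Finset.Subset.antisymm
    · intro z hz
      rcases hel z hz with rfl | rfl | rfl | rfl | rfl
      · simp
      · exact absurd hz h1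
      · simp
      · simp
      · simp
    · intro z hz
      simp only [Finset.mem_insert, Finset.mem_singleton] at hz
      rcases hz with rfl | rfl | rfl | rfl <;> assumption
  · exact absurd (hμ0b Z hZ h3 h4) hμZ
  · exact absurd (hμ0c Z hZ hwZ (fun h => h1 h.1) (fun h => h3 h.1)) hμZ
  · exact absurd (hμ0c Z hZ hwZ (fun h => h1 h.1) (fun h => h3 h.1)) hμZ
  · -- `B`
    right; left
    apply Finset.Subset.antisymm
    · intro z hz
      rcases hel z hz with rfl | rfl | rfl | rfl | rfl
      · simp
      · exact absurd hz h1
      · exact absurd hz h2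
      · simp
      · simp
    · intro z hz
      simp only [Finset.mem_insert, Finset.mem_singleton] at hz
      rcases hz with rfl | rfl | rfl <;> assumption
  · exact absurd (hμ0b Z hZ h3 h4) hμZ
  · exact absurd (hμ0c Z hZ hwZ (fun h => h1 h.1) (fun h => h3 h.1)) hμZ
  · exact absurd (hμ0c Z hZ hwZ (fun h => h1 h.1) (fun h => h3 h.1)) hμZ

/-- **Every up-set of the pivotal family of two chains has a nonnegative block**, given the ten
blocks and the classification of the traces of nonzero term (an abstract, small-context form). -/
lemma twoChains_upset_block_nonneg (P : Finset V) {w v₁ v₂ v₃ v₄ : V} (T : Finset V → R)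
    (A B C D : Finset V) (hAdef : A = {w, v₁, v₂}) (hBdef : B = {w, v₃, v₄})
    (hCdef : C = {w, v₁, v₂, v₄}) (hDdef : D = {w, v₂, v₃, v₄}) (hwP : w ∈ P)
    (hAP : A ⊆ P) (hBP : B ⊆ P) (hCP : C ⊆ P) (hDP : D ⊆ P) (hAC : A ⊆ C) (hBD : B ⊆ D)
    (mA1 : v₁ ∈ A) (mA2 : v₂ ∈ A) (mA3 : v₃ ∉ A) (mA4 : v₄ ∉ A)
    (mB1 : v₁ ∉ B) (mB2 : v₂ ∉ B) (mB3 : v₃ ∈ B) (mB4 : v₄ ∈ B)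
    (mC1 : v₁ ∈ C) (mC2 : v₂ ∈ C) (mC3 : v₃ ∉ C) (mC4 : v₄ ∈ C)
    (mD1 : v₁ ∉ D) (mD2 : v₂ ∈ D) (mD3 : v₃ ∈ D) (mD4 : v₄ ∈ D)
    (mP1 : v₁ ∈ P) (mP2 : v₂ ∈ P) (mP3 : v₃ ∈ P) (mP4 : v₄ ∈ P)
    (hclass : ∀ Z ∈ P.powerset, w ∈ Z → T Z ≠ 0 → Z = A ∨ Z = B ∨ Z = C ∨ Z = D ∨ Z = P)
    (hAv : 0 ≤ ∑ Z ∈ P.powerset.filter (fun Z => Disjoint Z {w}), T Z)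
    (hTop : 0 ≤ ∑ Z ∈ P.powerset.filter (fun Z => Disjoint Z {w} ∨ Z = P), T Z)
    (hC₁ : 0 ≤ ∑ Z ∈ P.powerset.filter (fun Z => Disjoint Z {w} ∨ v₁ ∈ Z), T Z)
    (hC₂ : 0 ≤ ∑ Z ∈ P.powerset.filter (fun Z => Disjoint Z {w} ∨ v₂ ∈ Z), T Z)
    (hC₃ : 0 ≤ ∑ Z ∈ P.powerset.filter (fun Z => Disjoint Z {w} ∨ v₃ ∈ Z), T Z)
    (hC₄ : 0 ≤ ∑ Z ∈ P.powerset.filter (fun Z => Disjoint Z {w} ∨ v₄ ∈ Z), T Z)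
    (hAll : 0 ≤ ∑ Z ∈ P.powerset, T Z)
    (hHC : 0 ≤ ∑ Z ∈ P.powerset.filter (fun Z => Disjoint Z {w} ∨ (v₁ ∈ Z ∧ v₄ ∈ Z)), T Z)
    (hHD : 0 ≤ ∑ Z ∈ P.powerset.filter (fun Z => Disjoint Z {w} ∨ (v₃ ∈ Z ∧ v₂ ∈ Z)), T Z)
    (hHCD : 0 ≤ ∑ Z ∈ P.powerset.filter (fun Z => Disjoint Z {w} ∨ (v₂ ∈ Z ∧ v₄ ∈ Z)), T Z)
    (U : Finset (Finset V)) (hUI : U ⊆ P.powerset.filter (fun Z => w ∈ Z))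
    (hUup : ∀ Z ∈ U, ∀ Z' ∈ P.powerset.filter (fun Z => w ∈ Z), Z ⊆ Z' → Z' ∈ U) :
    0 ≤ (∑ Z ∈ P.powerset.filter (fun Z => Disjoint Z {w}), T Z) + ∑ Z ∈ U, T Z := by
  set I : Finset (Finset V) := P.powerset.filter (fun Z => w ∈ Z) with hIdef
  have hwA : w ∈ A := by rw [hAdef]; simp
  have hwB : w ∈ B := by rw [hBdef]; simp
  have hwC : w ∈ C := by rw [hCdef]; simp
  have hwD : w ∈ D := by rw [hDdef]; simp
  have hAI : A ∈ I := by rw [hIdef, Finset.mem_filter]; exact ⟨Finset.mem_powerset.mpr hAP, hwA⟩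
  have hBI : B ∈ I := by rw [hIdef, Finset.mem_filter]; exact ⟨Finset.mem_powerset.mpr hBP, hwB⟩
  have hCI : C ∈ I := by rw [hIdef, Finset.mem_filter]; exact ⟨Finset.mem_powerset.mpr hCP, hwC⟩
  have hDI : D ∈ I := by rw [hIdef, Finset.mem_filter]; exact ⟨Finset.mem_powerset.mpr hDP, hwD⟩
  have hPI : P ∈ I := by rw [hIdef, Finset.mem_filter]; exact ⟨Finset.mem_powerset_self _, hwP⟩
  have dA : ¬ Disjoint A {w} := fun h => Finset.disjoint_singleton_right.mp h hwA
  have dB : ¬ Disjoint B {w} := fun h => Finset.disjoint_singleton_right.mp h hwB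
  have dC : ¬ Disjoint C {w} := fun h => Finset.disjoint_singleton_right.mp h hwC
  have dD : ¬ Disjoint D {w} := fun h => Finset.disjoint_singleton_right.mp h hwD
  have dP : ¬ Disjoint P {w} := fun h => Finset.disjoint_singleton_right.mp h hwP
  have hAne : A ≠ P := fun h => mA3 (h ▸ mP3)
  have hBne : B ≠ P := fun h => mB1 (h ▸ mP1)
  have hCne : C ≠ P := fun h => mC3 (h ▸ mP3)
  have hDne : D ≠ P := fun h => mD1 (h ▸ mP1)
  -- `b + Σ_U T = Σ_{Z ∌ w ∨ Z ∈ U} T`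
  have hkey : (∑ Z ∈ P.powerset.filter (fun Z => Disjoint Z {w}), T Z) + ∑ Z ∈ U, T Z =
      ∑ Z ∈ P.powerset.filter (fun Z => Disjoint Z {w} ∨ Z ∈ U), T Z := by
    have hs := Finset.sum_filter_add_sum_filter_not (P.powerset.filter (fun Z => Disjoint Z {w} ∨ Z ∈ U))
      (fun Z => Disjoint Z {w}) T
    have f1 : (P.powerset.filter (fun Z => Disjoint Z {w} ∨ Z ∈ U)).filter (fun Z => Disjoint Z {w}) =
        P.powerset.filter (fun Z => Disjoint Z {w}) := by
      rw [Finset.filter_filter]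
      exact Finset.filter_congr fun Z _ => ⟨fun h => h.2, fun h => ⟨Or.inl h, h⟩⟩
    have f2 : (P.powerset.filter (fun Z => Disjoint Z {w} ∨ Z ∈ U)).filter (fun Z => ¬ Disjoint Z {w}) = U := by
      ext Z
      rw [Finset.mem_filter, Finset.mem_filter]
      constructor
      · rintro ⟨⟨_, h | h⟩, hn⟩
        · exact absurd h hn
        · exact h
      · intro hZU
        have hZI := hUI hZU
        rw [Finset.mem_filter] at hZI
        exact ⟨⟨hZI.1, Or.inr hZU⟩, fun hd => Finset.disjoint_singleton_right.mp hd hZI.2⟩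
    rw [f1, f2] at hs
    linarith [hs]
  rw [hkey]
  have imt : ∀ {Z : Finset V} {q : Prop}, Z ∈ U → q → (Z ∈ U ↔ q) := fun hZ hq => ⟨fun _ => hq, fun _ => hZ⟩
  have imf : ∀ {Z : Finset V} {q : Prop}, Z ∉ U → ¬ q → (Z ∈ U ↔ q) :=
    fun hZ hq => ⟨fun h => absurd h hZ, fun h => absurd h hq⟩
  -- the congruence tool
  have hcongr : ∀ (q : Finset V → Prop) [DecidablePred q],
      (∀ Z ∈ P.powerset, Disjoint Z {w} → q Z) →
      (A ∈ U ↔ q A) → (B ∈ U ↔ q B) → (C ∈ U ↔ q C) → (D ∈ U ↔ q D) → (P ∈ U ↔ q P) →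
      ∑ Z ∈ P.powerset.filter (fun Z => Disjoint Z {w} ∨ Z ∈ U), T Z = ∑ Z ∈ P.powerset.filter q, T Z := by
    intro q _ hq hqA hqB hqC hqD hqP
    refine sum_filter_congr_of_ne_zero _ T _ _ fun Z hZ hT => ?_
    by_cases hd : Disjoint Z {w}
    · exact ⟨fun _ => hq Z hZ hd, fun _ => Or.inl hd⟩
    · have hwZ : w ∈ Z := by
        by_contra h; exact hd (Finset.disjoint_singleton_right.mpr h)
      rcases hclass Z hZ hwZ hT with rfl | rfl | rfl | rfl | rfl
      · exact ⟨fun h => hqA.mp (h.resolve_left hd), fun h => Or.inr (hqA.mpr h)⟩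
      · exact ⟨fun h => hqB.mp (h.resolve_left hd), fun h => Or.inr (hqB.mpr h)⟩
      · exact ⟨fun h => hqC.mp (h.resolve_left hd), fun h => Or.inr (hqC.mpr h)⟩
      · exact ⟨fun h => hqD.mp (h.resolve_left hd), fun h => Or.inr (hqD.mpr h)⟩
      · exact ⟨fun h => hqP.mp (h.resolve_left hd), fun h => Or.inr (hqP.mpr h)⟩
  -- the up-set structure
  have upAC : A ∈ U → C ∈ U := fun h => hUup A h C hCI hAC
  have upCP : C ∈ U → P ∈ U := fun h => hUup C h P hPI hCP
  have upBD : B ∈ U → D ∈ U := fun h => hUup B h D hDI hBD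
  have upDP : D ∈ U → P ∈ U := fun h => hUup D h P hPI hDP
  clear hUup hUI hkey hclass
  by_cases hA : A ∈ U <;> by_cases hB : B ∈ U <;> by_cases hC : C ∈ U <;> by_cases hD : D ∈ U <;>
    by_cases hP : P ∈ U
  all_goals first
    | exact absurd (upAC hA) hC
    | exact absurd (upCP hC) hP
    | exact absurd (upBD hB) hD
    | exact absurd (upDP hD) hP
    | skip
  · -- all
    rw [hcongr (fun _ => True) (fun _ _ _ => trivial) (imt hA trivial) (imt hB trivial)
      (imt hC trivial) (imt hD trivial) (imt hP trivial), Finset.filter_true_of_mem (fun _ _ => trivial)]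
    exact hAll
  · -- `𝒱_{v₂} = {A, C, D, E}`
    rw [hcongr (fun Z => Disjoint Z {w} ∨ v₂ ∈ Z) (fun _ _ h => Or.inl h) (imt hA (Or.inr mA2))
      (imf hB (fun h => h.elim dB mB2)) (imt hC (Or.inr mC2)) (imt hD (Or.inr mD2))
      (imt hP (Or.inr mP2))]
    exact hC₂
  · -- `𝒱_{v₁} = {A, C, E}`
    rw [hcongr (fun Z => Disjoint Z {w} ∨ v₁ ∈ Z) (fun _ _ h => Or.inl h) (imt hA (Or.inr mA1))
      (imf hB (fun h => h.elim dB mB1)) (imt hC (Or.inr mC1)) (imf hD (fun h => h.elim dD mD1))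
      (imt hP (Or.inr mP1))]
    exact hC₁
  · -- `𝒱_{v₄} = {B, C, D, E}`
    rw [hcongr (fun Z => Disjoint Z {w} ∨ v₄ ∈ Z) (fun _ _ h => Or.inl h)
      (imf hA (fun h => h.elim dA mA4)) (imt hB (Or.inr mB4)) (imt hC (Or.inr mC4))
      (imt hD (Or.inr mD4)) (imt hP (Or.inr mP4))]
    exact hC₄
  · -- `𝒱_{v₃} = {B, D, E}`
    rw [hcongr (fun Z => Disjoint Z {w} ∨ v₃ ∈ Z) (fun _ _ h => Or.inl h)
      (imf hA (fun h => h.elim dA mA3)) (imt hB (Or.inr mB3)) (imf hC (fun h => h.elim dC mC3))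
      (imt hD (Or.inr mD3)) (imt hP (Or.inr mP3))]
    exact hC₃
  · -- `{C, D, E}`
    rw [hcongr (fun Z => Disjoint Z {w} ∨ (v₂ ∈ Z ∧ v₄ ∈ Z)) (fun _ _ h => Or.inl h)
      (imf hA (fun h => h.elim dA (fun h' => mA4 h'.2)))
      (imf hB (fun h => h.elim dB (fun h' => mB2 h'.1))) (imt hC (Or.inr ⟨mC2, mC4⟩))
      (imt hD (Or.inr ⟨mD2, mD4⟩)) (imt hP (Or.inr ⟨mP2, mP4⟩))]
    exact hHCD
  · -- `{C, E}`
    rw [hcongr (fun Z => Disjoint Z {w} ∨ (v₁ ∈ Z ∧ v₄ ∈ Z)) (fun _ _ h => Or.inl h)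
      (imf hA (fun h => h.elim dA (fun h' => mA4 h'.2)))
      (imf hB (fun h => h.elim dB (fun h' => mB1 h'.1))) (imt hC (Or.inr ⟨mC1, mC4⟩))
      (imf hD (fun h => h.elim dD (fun h' => mD1 h'.1))) (imt hP (Or.inr ⟨mP1, mP4⟩))]
    exact hHC
  · -- `{D, E}`
    rw [hcongr (fun Z => Disjoint Z {w} ∨ (v₃ ∈ Z ∧ v₂ ∈ Z)) (fun _ _ h => Or.inl h)
      (imf hA (fun h => h.elim dA (fun h' => mA3 h'.1)))
      (imf hB (fun h => h.elim dB (fun h' => mB2 h'.2)))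
      (imf hC (fun h => h.elim dC (fun h' => mC3 h'.1))) (imt hD (Or.inr ⟨mD3, mD2⟩))
      (imt hP (Or.inr ⟨mP3, mP2⟩))]
    exact hHD
  · -- `{E}`
    rw [hcongr (fun Z => Disjoint Z {w} ∨ Z = P) (fun _ _ h => Or.inl h)
      (imf hA (fun h => h.elim dA hAne)) (imf hB (fun h => h.elim dB hBne))
      (imf hC (fun h => h.elim dC hCne)) (imf hD (fun h => h.elim dD hDne)) (imt hP (Or.inr rfl))]
    exact hTop
  · -- `∅`
    rw [hcongr (fun Z => Disjoint Z {w}) (fun _ _ h => h) (imf hA dA) (imf hB dB) (imf hC dC)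
      (imf hD dD) (imf hP dP)]
    exact hAv

end TwoChainsUpsets

end Summit.Ventures.PercRepro2.Coin
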